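import Literature.NumberTheory.EllipticCurves.BSDRankZeroDensity
import Literature.NumberTheory.EllipticCurves.BSDRankZeroSieve
import Literature.NumberTheory.EllipticCurves.BhargavaShankarCountingProofs
import Mathlib.Data.ZMod.Basic
import HarnessLib

/-!
# The root-number family of Bhargava–Shankar, §4.1, in coordinates

Topic `Literature/NumberTheory/EllipticCurves`, family `bsd` (**bsd.S26**). Third file of the
decomposition of the named fact `Literature.NumberTheory.EllipticCurves.pos_proportion_rank_zero`
(`BSDWave0.lean`) after

> M. Bhargava, A. Shankar, *Ternary cubic forms having bounded invariants, and the existence of a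
> positive proportion of elliptic curves having rank 0*, Ann. of Math. (2) 181 (2015) 587–621
> = arXiv:1007.0052**v2** (24 Dec 2013; theorem numbers below are those of v2: Thm 4, Thm 27,
> Thm 37, Thm 41, Thm 42; the `lit` store holds v1, whose §4.1 family and numbering differ),

continuing `BSDRankZeroDensity.lean` (the deduction `pos_proportion_rank_zero_of_facts` of Thm 4 from
Thm 27, Thm 42 and the composite existence fact `exists_isLarge_rootNumber_twist_family` for the
§4.1 family) and `BSDRankZeroSieve.lean` (the elementary sieve `RankZeroSieve.main_count`). Here the
composite existence fact is **proved** from a single, sharper named fact — the one sentence of §4.1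
that is a statement about root numbers — so that `pos_proportion_rank_zero` rests on exactly three
printed inputs: Thm 27 (average `#Sel₃ ≤ 4` in large families), Thm 42 (Dokchitser–Dokchitser) and
the root-number sentence of §4.1 (`pos_proportion_rank_zero_of_facts₂`).

## The source (§4.1 of arXiv:1007.0052v2, after the proof of Thm 41)

"Let `F` denote the set of all elliptic curves `E` over `ℚ` satisfying the following conditions:
• The curve `E` and its twist `E₋₁` both have additive reduction at `2`, and furthermore the
`j`-invariant of both curves `E` and `E₋₁` are `2`-adic units. • `E` has square-free discriminant
away from `2`. • `Δ'(E) ≡ 1 (mod 4)`, where `Δ'(E) := |Δ(E)/2^{v₂(Δ(E))}|` is the positive odd part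
of the discriminant of `E`. The set `F` is a large family. Moreover, if `E ∈ F`, then the twist
`E₋₁` of `E` by `-1` is also clearly in `F` […]. Now for a prime factor `p` of the discriminant, we
have already observed that `ω_p(E) = -ω_p(E₋₁)` if and only if `p ≡ 3 (mod 4)`. Furthermore, the
first condition implies that `ω₂(E) = -ω₂(E₋₁)` (see [SW, Lemma 12])" — S. Wong, *On the density of
elliptic curves*, Compositio Math. 127 (2001) 23–54 — "therefore, `ω(E) = -ω(E₋₁)` for all
`E ∈ F`. Since the height of an elliptic curve also remains the same under twisting by `-1`, it
follows that a density of exactly `50%` of elliptic curves in `F`, when ordered by height, have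
root number `+1`, as desired."

## The subfamily `IsBSFamily` and why it lies in `F`

Curves are the `E_{A,B} : y² = x³ + Ax + B` of the height family (`shortWeierstrass`,
`IsInHeightFamily` of `HeightFamily.lean`), `D = D(A, B) = 4A³ + 27B² = RankZeroSieve.negDisc (A, B)`, so that
`Δ(E_{A,B}) = -16·D`, `c₄ = -48A`, `j = 2⁸·27·A³/D`, and `E₋₁ = E_{A,-B}` (`negB`). For a sign
`s` (`s = true`: `D > 0`, i.e. `Δ < 0`; `s = false`: `D < 0`) the predicate `IsBSFamily s (A, B)` is:
`A ≡ 4 (mod 8)`; `D ≡ 2¹⁴ (mod 2¹⁶)` if `s = true`, `D ≡ -2¹⁴ (mod 2¹⁶)` if `s = false`; `D` is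
divisible by the square of no odd prime (`RankZeroSieve.OddSqfree`); and `D` has the sign `s`.
Every such curve is in `F`: (i) `v₂(A) = 2` and `v₂(D) = 14` give `v₂(j) = 8 + 6 - 14 = 0` for
`E_{A,±B}` (same `A`, same `D`), and `v₂(Δ(E_{A,±B})) = 18`, so the minimal discriminant at `2` has
valuation `18` or `6`, in particular `> 0`: the reduction at `2` is bad, and not multiplicative since
`v₂(j) = 0`, hence additive, for both `E` and `E₋₁`; (ii) for odd `p`, `p² ∤ D` gives
`v_p(Δ(E_{A,B})) ≤ 1 < 12`, so the model is minimal at `p` and the discriminant of `E` is squarefree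
away from `2`; (iii) by (ii) the positive odd part of the (minimal) discriminant is `|D|/2¹⁴`, which is
`≡ 1 (mod 4)` exactly when `D ≡ 2¹⁴ (mod 2¹⁶)` and `D > 0`, or `D ≡ -2¹⁴ (mod 2¹⁶)` and `D < 0`.
(The source indexes curves by `(I, J) = (-3A, -27B)` and `Δ(I, J) = -D`; the conditions are the
same.) Conversely `F` contains curves with `v₂(A) ≠ 2`, so `IsBSFamily` is a proper subfamily: the
vendored fact below is the printed sentence *restricted* to it, never more.

## Contents

* `IsBSFamily`, `bsFamily s : CongruenceFamily` (the same family as data: residues modulo `2¹⁶` at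
  `2`, modulo `p²` at odd `p`, one sign at infinity), `mem_bsFamily_iff`.
* The ONE named fact `rootNumber_negB_of_isBSFamily`: `ω(E_{A,-B}) = -ω(E_{A,B})` on the subfamily
  (`WeierstrassCurve.rootNumber`, the analytic sign of `RootNumber.lean`, which is how the source
  defines `ω`, §4.1 first paragraph). It is not reducible to the tree's
  `rootNumber_eq_algebraicRootNumber`, whose hypothesis excludes additive reduction at `2`, where
  `WeierstrassCurve.localRootNumber` is a documented junk value.
* Proved: `isLarge_bsFamily` ("The set `F` is a large family": Chinese remainder theorem and the
  sieve count `RankZeroSieve.main_count`), `exists_pos_le_heightProportion_isBSFamily` (positive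
  proportion: `main_count` against the tree's `card_heightFamilyBelow_asymptotic_holds` of
  `BhargavaShankarCountingProofs.lean`, Lemma 5.15 of Bhargava–Shankar's binary quartic paper for the
  family of all curves), stability under `negB` and disjointness of the two
  sign pieces, `exists_isLarge_rootNumber_twist_family_of_rootNumber_negB` (the composite fact of
  `BSDRankZeroDensity.lean` from the single sentence) and `pos_proportion_rank_zero_of_facts₂`
  (Thm 4 from Thm 27, Thm 42 and the sentence).

## References

* [BhargavaShankarTernary2015] M. Bhargava, A. Shankar, Ann. of Math. (2) 181 (2015) 587–621,
  doi:10.4007/annals.2015.181.2.4 = arXiv:1007.0052v2: Thm 4, §3 (large families, p. 14), Thm 27,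
  Thm 37, §4.1 (the family `F` and `ω(E) = -ω(E₋₁)`).
* S. Wong, *On the density of elliptic curves*, Compositio Math. 127 (2001), no. 1, 23–54, Lemma 12
  (the source's reference [SW] for `ω₂(E) = -ω₂(E₋₁)`; not cited in `[cite:]` form).
* D. Rohrlich, *Variation of the root number in families of elliptic curves*, Compositio Math. 87
  (1993) 119–151 (the source's [Rh] for `ω_p` at multiplicative primes).
-/

noncomputable section

open scoped Classical
open Filter Finset WeierstrassCurve
open Literature.NumberTheory.EllipticCurves.RankZeroSieve

namespace Literature.NumberTheory.EllipticCurves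

/-! ### The subfamily in coordinates -/

section Family

/-- The prescribed residue of `D = 4A³ + 27B²` modulo `2¹⁶`: `2¹⁴` for the sign `s = true` (`D > 0`)
and `-2¹⁴` for `s = false` (`D < 0`), so that `2¹⁴ ∥ D` and the positive odd part `|D|/2¹⁴` of the
discriminant is `≡ 1 (mod 4)` (third condition of the source's §4.1 family).
[cite: BhargavaShankarTernary2015, §4.1 (arXiv v2), definition of F, third condition] -/
def bsResidue (s : Bool) : ℤ := if s then 2 ^ 14 else -2 ^ 14

/-- **The subfamily of Bhargava–Shankar's §4.1 family `F` with `v₂(A) = 2`, sign piece `s`**, as a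
predicate on the coefficients `(A, B)` of `E_{A,B} : y² = x³ + Ax + B`: `A ≡ 4 (mod 8)`,
`4A³ + 27B² ≡ ±2¹⁴ (mod 2¹⁶)` (sign `±` according to `s`), `4A³ + 27B²` divisible by the square of no
odd prime, and `4A³ + 27B²` of sign `s` (`s = true`: positive, i.e. `Δ(E_{A,B}) = -16(4A³ + 27B²) < 0`).
See the module docstring for the verification that these curves satisfy the three printed
conditions (additive at `2` with `2`-adic unit `j` for `E` and `E₋₁`; squarefree discriminant away
from `2`; `Δ' ≡ 1 (mod 4)`). [cite: BhargavaShankarTernary2015, §4.1 (arXiv v2), definition of the family F] -/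
def IsBSFamily (s : Bool) (AB : ℤ × ℤ) : Prop :=
  AB.1 ≡ 4 [ZMOD 8] ∧ negDisc AB ≡ bsResidue s [ZMOD 2 ^ 16] ∧ OddSqfree AB ∧
    (if s then 0 < negDisc AB else negDisc AB < 0)

/-- The exponent `k_p` of the local condition of the subfamily: residues modulo `2¹⁶` at `p = 2` and
modulo `p²` at odd `p` (source §3, p. 14: a family defined by congruence conditions is given by closed
sets `Σ_p ⊆ ℤ_p²`; here clopen). [cite: BhargavaShankarTernary2015, §3 (arXiv v2 p. 14)] -/
def bsExpt (p : ℕ) : ℕ := if p = 2 then 16 else 2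

/-- The local condition of the subfamily at `p`, on integer representatives: at `2`,
`A ≡ 4 (mod 8)` and `4A³ + 27B² ≡ ±2¹⁴ (mod 2¹⁶)`; at `p ≠ 2`, `p² ∤ 4A³ + 27B²`. It depends only on
`(A, B)` modulo `p ^ bsExpt p` (`bsLocalCond_of_modEq`).
[cite: BhargavaShankarTernary2015, §4.1 (arXiv v2), definition of the family F] -/
def BSLocalCond (s : Bool) (p : ℕ) (AB : ℤ × ℤ) : Prop :=
  if p = 2 then AB.1 ≡ 4 [ZMOD 8] ∧ negDisc AB ≡ bsResidue s [ZMOD 2 ^ 16]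
  else ¬ (p : ℤ) ^ 2 ∣ negDisc AB

/-- **The subfamily as a family defined by congruence conditions** (`CongruenceFamily` of
`BSDRankZeroDensity.lean`; source §3, p. 14): at each prime `p` the allowed residues modulo
`p ^ bsExpt p` are those of the integer pairs satisfying `BSLocalCond s p`; at infinity only the sign
`s` of `4A³ + 27B²` is allowed (`allowPos`, positive discriminant, is `s = false`). Its membership
predicate is `IsBSFamily s` (`mem_bsFamily_iff`).
[cite: BhargavaShankarTernary2015, §3 (arXiv v2 p. 14) and §4.1 (the family F)] -/
def bsFamily (s : Bool) : CongruenceFamily where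
  expt := bsExpt
  residues p := {xy | ∃ AB : ℤ × ℤ, BSLocalCond s p AB ∧
    xy = ((AB.1 : ZMod (p ^ bsExpt p)), (AB.2 : ZMod (p ^ bsExpt p)))}
  allowPos := s = false
  allowNeg := s = true

/-- The two sign pieces, indexed by `Fin 2` as required by `UnionMem`
(`0 ↦ s = true`, `1 ↦ s = false`). [cite: BhargavaShankarTernary2015, §4.1 (arXiv v2), the family F] -/
def bsFamilies : Fin 2 → CongruenceFamily := ![bsFamily true, bsFamily false]

/-- The local condition depends only on residues modulo `p ^ bsExpt p`. [folklore] -/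
theorem bsLocalCond_of_modEq {s : Bool} {p : ℕ} {AB AB' : ℤ × ℤ} (h : BSLocalCond s p AB')
    (h1 : AB.1 ≡ AB'.1 [ZMOD (p : ℤ) ^ bsExpt p]) (h2 : AB.2 ≡ AB'.2 [ZMOD (p : ℤ) ^ bsExpt p]) :
    BSLocalCond s p AB := by
  unfold BSLocalCond at h ⊢
  by_cases hp : p = 2
  · subst hp
    rw [if_pos rfl] at h ⊢
    have e : ((2 : ℕ) : ℤ) ^ bsExpt 2 = 2 ^ 16 := by simp [bsExpt]
    rw [e] at h1 h2
    have hD : negDisc AB ≡ negDisc AB' [ZMOD 2 ^ 16] := negDisc_modEq h1 h2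
    exact ⟨(h1.of_dvd (by norm_num)).trans h.1, hD.trans h.2⟩
  · rw [if_neg hp] at h ⊢
    have e : bsExpt p = 2 := if_neg hp
    rw [e] at h1 h2
    have hD : negDisc AB ≡ negDisc AB' [ZMOD (p : ℤ) ^ 2] := negDisc_modEq h1 h2
    exact fun hdvd ↦ h (hD.dvd_iff.mp hdvd)

/-- If `4A³ + 27B²` has a sign then it is nonzero (both branches of the sign condition). [folklore] -/
theorem negDisc_ne_zero_of_sign {s : Bool} {AB : ℤ × ℤ}
    (h : if s then 0 < negDisc AB else negDisc AB < 0) : negDisc AB ≠ 0 := by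
  cases s
  · simp only [Bool.false_eq_true, ↓reduceIte] at h; exact h.ne
  · simp only [↓reduceIte] at h; exact h.ne'

/-- Members of the subfamily are in the height family: `4A³ + 27B² ≠ 0`, `2⁴ ∤ A` (as `A ≡ 4 (mod 8)`),
and for odd `p`, `p⁴ ∣ A`, `p⁶ ∣ B` would give `p² ∣ 4A³ + 27B²`. [folklore] -/
theorem IsBSFamily.isInHeightFamily {s : Bool} {AB : ℤ × ℤ} (h : IsBSFamily s AB) :
    IsInHeightFamily AB := by
  obtain ⟨hA, _, hsq, hsign⟩ := h
  refine ⟨negDisc_ne_zero_of_sign hsign, fun p hp ⟨h4, h6⟩ ↦ ?_⟩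
  by_cases hp2 : p = 2
  · subst hp2
    have h8 : (8 : ℤ) ∣ AB.1 := dvd_trans ⟨2, by norm_num⟩ h4
    have h0 : AB.1 % 8 = 0 := Int.emod_eq_zero_of_dvd h8
    have h4' : AB.1 % 8 = 4 := hA
    omega
  · obtain ⟨a, ha⟩ := h4
    obtain ⟨b, hb⟩ := h6
    refine hsq p hp hp2 ⟨4 * (p : ℤ) ^ 10 * a ^ 3 + 27 * (p : ℤ) ^ 10 * b ^ 2, ?_⟩
    change 4 * AB.1 ^ 3 + 27 * AB.2 ^ 2 = _
    rw [ha, hb]; ring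

/-- **`bsFamily s` has membership predicate `IsBSFamily s`.** [folklore] -/
theorem mem_bsFamily_iff (s : Bool) (AB : ℤ × ℤ) : (bsFamily s).Mem AB ↔ IsBSFamily s AB := by
  constructor
  · rintro ⟨hfam, hloc, hpos, hneg⟩
    -- transfer of the local conditions from the witnesses to `AB`
    have hcond : ∀ p : ℕ, p.Prime → BSLocalCond s p AB := by
      intro p hp
      obtain ⟨AB', hc, heq⟩ := hloc p hp
      obtain ⟨e1, e2⟩ := Prod.mk.inj heq
      have e1' : AB.1 ≡ AB'.1 [ZMOD ((p ^ bsExpt p : ℕ) : ℤ)] :=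
        (ZMod.intCast_eq_intCast_iff _ _ _).mp e1
      have e2' : AB.2 ≡ AB'.2 [ZMOD ((p ^ bsExpt p : ℕ) : ℤ)] :=
        (ZMod.intCast_eq_intCast_iff _ _ _).mp e2
      push_cast at e1' e2'
      exact bsLocalCond_of_modEq hc e1' e2'
    have h2 := hcond 2 Nat.prime_two
    simp only [BSLocalCond, ↓reduceIte] at h2
    refine ⟨h2.1, h2.2, fun p hp hp2 ↦ ?_, ?_⟩
    · have := hcond p hp
      simp only [BSLocalCond, hp2, ↓reduceIte] at this
      exact this
    · have hD : negDisc AB ≠ 0 := hfam.1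
      change (0 < -negDisc AB → s = false) at hpos
      change (-negDisc AB < 0 → s = true) at hneg
      cases s
      · simp only [Bool.false_eq_true, ↓reduceIte]
        rcases lt_trichotomy (negDisc AB) 0 with h | h | h
        · exact h
        · exact (hD h).elim
        · exact absurd (hneg (by linarith)) (by decide)
      · simp only [↓reduceIte]
        rcases lt_trichotomy (negDisc AB) 0 with h | h | h
        · exact absurd (hpos (by linarith)) (by decide)
        · exact (hD h).elim
        · exact h
  · intro h
    have hfam := h.isInHeightFamily
    obtain ⟨hA, hDres, hsq, hsign⟩ := h
    refine ⟨hfam, fun p hp ↦ ⟨AB, ?_, rfl⟩, ?_, ?_⟩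
    · unfold BSLocalCond
      by_cases hp2 : p = 2
      · rw [if_pos hp2]; exact ⟨hA, hDres⟩
      · rw [if_neg hp2]; exact hsq p hp hp2
    · change (0 < -negDisc AB → s = false)
      intro h0
      cases s
      · rfl
      · simp only [↓reduceIte] at hsign; linarith
    · change (-negDisc AB < 0 → s = true)
      intro h0
      cases s
      · simp only [Bool.false_eq_true, ↓reduceIte] at hsign; linarith
      · rfl

/-- Membership in the union of the two sign pieces. [folklore] -/
theorem unionMem_bsFamilies_iff (AB : ℤ × ℤ) :
    UnionMem bsFamilies AB ↔ IsBSFamily true AB ∨ IsBSFamily false AB := by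
  simp only [UnionMem, Fin.exists_fin_two, bsFamilies, Matrix.cons_val_zero, Matrix.cons_val_one,
    mem_bsFamily_iff]

/-- The two sign pieces are disjoint (their members have `4A³ + 27B²` of opposite signs). [folklore] -/
theorem bsFamilies_disjoint (i j : Fin 2) (hij : i ≠ j) (AB : ℤ × ℤ) (hi : (bsFamilies i).Mem AB) :
    ¬ (bsFamilies j).Mem AB := by
  intro hj
  have key : ∀ AB : ℤ × ℤ, IsBSFamily true AB → IsBSFamily false AB → False := by
    intro AB h₁ h₂
    have a := h₁.2.2.2
    have b := h₂.2.2.2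
    simp only [↓reduceIte, Bool.false_eq_true] at a b
    linarith
  fin_cases i <;> fin_cases j
  · exact hij rfl
  · simp only [bsFamilies, Fin.zero_eta, Fin.mk_one, Matrix.cons_val_zero, Matrix.cons_val_one,
      mem_bsFamily_iff] at hi hj
    exact key AB hi hj
  · simp only [bsFamilies, Fin.zero_eta, Fin.mk_one, Matrix.cons_val_zero, Matrix.cons_val_one,
      mem_bsFamily_iff] at hi hj
    exact key AB hj hi
  · exact hij rfl

/-! ### The twist by `-1` -/

/-- `4A³ + 27B²` is even in `B`: `D(A, -B) = D(A, B)`. [folklore] -/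
theorem negDisc_negB (AB : ℤ × ℤ) : negDisc (negB AB) = negDisc AB := by
  simp only [negDisc, negB, even_two, Even.neg_pow]

/-- `OddSqfree` is invariant under `B ↦ -B`. [folklore] -/
theorem oddSqfree_negB_iff (AB : ℤ × ℤ) : OddSqfree (negB AB) ↔ OddSqfree AB := by
  simp only [OddSqfree, negDisc_negB]

/-- "If `E ∈ F`, then the twist `E₋₁` of `E` by `-1` is also clearly in `F`" (source §4.1), for the
subfamily: `IsBSFamily s (A, -B) ↔ IsBSFamily s (A, B)` (all conditions are on `A` and
`D = 4A³ + 27B²`). [cite: BhargavaShankarTernary2015, §4.1 (arXiv v2)] -/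
theorem isBSFamily_negB_iff (s : Bool) (AB : ℤ × ℤ) : IsBSFamily s (negB AB) ↔ IsBSFamily s AB := by
  simp only [IsBSFamily, negDisc_negB, oddSqfree_negB_iff]
  rfl

/-- The union of the two sign pieces is stable under `E ↦ E₋₁`. [folklore] -/
theorem unionMem_bsFamilies_negB {AB : ℤ × ℤ} (h : UnionMem bsFamilies AB) :
    UnionMem bsFamilies (AB.1, -AB.2) := by
  rw [unionMem_bsFamilies_iff] at h ⊢
  change IsBSFamily true (negB AB) ∨ IsBSFamily false (negB AB)
  rwa [isBSFamily_negB_iff, isBSFamily_negB_iff]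

end Family

/-! ### The named fact: the root number changes sign under the twist by `-1` on `F` -/

section Fact

/-- **Bhargava–Shankar, §4.1 (arXiv:1007.0052v2; Ann. of Math. 181 (2015)), the sentence
"`ω(E) = -ω(E₋₁)` for all `E ∈ F`", restricted to the subfamily `IsBSFamily`.** For every sign `s`
and every `(A, B)` with `IsBSFamily s (A, B)` — `A ≡ 4 (mod 8)`, `4A³ + 27B² ≡ ±2¹⁴ (mod 2¹⁶)` with
the sign of `4A³ + 27B²` equal to `s` and matching `±`, `4A³ + 27B²` squarefree away from `2` — the
global root numbers of `E_{A,B} : y² = x³ + Ax + B` and of its quadratic twist by `-1`,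
`E₋₁ = E_{A,-B}`, are opposite: `ω(E_{A,-B}) = -ω(E_{A,B})`. Here `ω = WeierstrassCurve.rootNumber`
is the sign of the functional equation of `L(E, s)` (`RootNumber.lean`), which is the source's
definition of the root number (§4.1, first paragraph). The source's argument: `ω(E) = -∏_p ω_p(E)`;
at an odd prime `p ∣ Δ` the reduction is multiplicative (squarefree discriminant away from `2`) and
`ω_p(E) = -ω_p(E₋₁)` iff `p ≡ 3 (mod 4)` (split iff `(-2J/p) = 1`, `J(E₋₁) = -J(E)`; Rohrlich); the
number of such `p` is even since `Δ' ≡ 1 (mod 4)` is squarefree; and `ω₂(E) = -ω₂(E₋₁)` for `E`,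
`E₋₁` additive at `2` with `2`-adic unit `j`-invariants (S. Wong, Compositio Math. 127 (2001), Lemma
12). That every `(A, B)` with `IsBSFamily s (A, B)` defines a member of `F` (with `E₋₁ = E_{A,-B}`) is
checked in the module docstring; the statement is vendored only for this subfamily (a restriction,
not a strengthening, of the printed sentence). Not reducible to the tree's local root numbers
(`WeierstrassCurve.localRootNumber` is junk at additive places above `2`).
[cite: BhargavaShankarTernary2015, §4.1 (arXiv v2), "ω(E) = −ω(E₋₁) for all E ∈ F"] -/
def rootNumber_negB_of_isBSFamily : Prop :=
  ∀ (s : Bool) (AB : ℤ × ℤ), IsBSFamily s AB →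
    (shortWeierstrass (negB AB)).rootNumber = -(shortWeierstrass AB).rootNumber

end Fact

/-! ### "The set `F` is a large family" (proved for the subfamily) -/

section Large

/-- Chinese remainder theorem for two coprime integer moduli (from a Bézout relation). [folklore] -/
theorem exists_modEq_and_modEq {m n : ℤ} (h : IsCoprime m n) (a b : ℤ) :
    ∃ x : ℤ, x ≡ a [ZMOD m] ∧ x ≡ b [ZMOD n] := by
  obtain ⟨u, v, huv⟩ := h
  refine ⟨b * (u * m) + a * (v * n), ?_, ?_⟩
  · rw [Int.modEq_iff_dvd]
    exact ⟨(a - b) * u, by linear_combination (-a) * huv⟩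
  · rw [Int.modEq_iff_dvd]
    exact ⟨(b - a) * v, by linear_combination (-b) * huv⟩

/-- Base points of the two `2`-adic classes: `(20, 176)` (`D = 2¹⁴·53`) for `s = true` and
`(-44, 48)` (`D = -2¹⁴·17`) for `s = false`. [folklore] -/
theorem exists_bsBase (s : Bool) :
    ∃ a₂ b₂ : ℤ, a₂ ≡ 4 [ZMOD 8] ∧ negDisc (a₂, b₂) ≡ bsResidue s [ZMOD 2 ^ 16] := by
  cases s
  · refine ⟨-44, 48, by decide, ?_⟩
    simp only [bsResidue, Bool.false_eq_true, ↓reduceIte, negDisc_apply]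
    decide
  · refine ⟨20, 176, by decide, ?_⟩
    simp only [bsResidue, ↓reduceIte, negDisc_apply]
    decide

/-- `2¹⁶` and a power of an odd prime are coprime. [folklore] -/
theorem isCoprime_two_pow_prime_pow {p : ℕ} (hp : p.Prime) (hp2 : p ≠ 2) (k : ℕ) :
    IsCoprime ((2 : ℤ) ^ 16) ((p : ℤ) ^ k) := by
  have h : Nat.Coprime (2 ^ 16) (p ^ k) :=
    Nat.Coprime.pow 16 k ((Nat.coprime_primes Nat.prime_two hp).mpr (Ne.symm hp2))
  exact_mod_cast h.isCoprime

/-- The sieve count is eventually at least `1`: a member of the prescribed class exists in the box.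
[folklore] -/
theorem exists_mem_box_class_oddSqfree (s : Bool) {N : ℕ} (hN : 0 < N) (a₀ b₀ : ℤ)
    (hcompat : ∀ p : ℕ, p.Prime → p ≠ 2 → (p : ℤ) ∣ N →
      (p : ℤ) ^ 2 ∣ N ∧ ¬ (p : ℤ) ^ 2 ∣ negDisc (a₀, b₀)) :
    ∃ (X : ℕ) (AB : ℤ × ℤ), AB ∈ Ibox s X ×ˢ Jbox X ∧
      (AB.1 ≡ a₀ [ZMOD N] ∧ AB.2 ≡ b₀ [ZMOD N]) ∧ OddSqfree AB := by
  obtain ⟨c, hc, hev⟩ := main_count s hN a₀ b₀ hcompat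
  have hgrow : Tendsto (fun X ↦ c * (aX X * bX X)) atTop atTop :=
    (tendsto_aX.atTop_mul_atTop₀ tendsto_bX).const_mul_atTop hc
  obtain ⟨X, h1, h2⟩ := ((hgrow.eventually_ge_atTop 1).and hev).exists
  have hpos : 0 < ((Ibox s X ×ˢ Jbox X).filter (fun AB : ℤ × ℤ ↦
      (AB.1 ≡ a₀ [ZMOD N] ∧ AB.2 ≡ b₀ [ZMOD N]) ∧ OddSqfree AB)).card := by
    have : (1 : ℝ) ≤ _ := h1.trans h2
    exact_mod_cast (show (0 : ℝ) < _ from lt_of_lt_of_le one_pos this)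
  obtain ⟨AB, hAB⟩ := Finset.card_pos.mp hpos
  rw [Finset.mem_filter] at hAB
  exact ⟨X, AB, hAB.1, hAB.2.1, hAB.2.2⟩

/-- **"The set `F` is a large family"** (source §4.1), for each sign piece of the subfamily: for every
odd prime `p`, every class `(a, b)` modulo `p ^ k` with `p² ∤ 4a³ + 27b²` contains a member (combine
the class with the `2`-adic class of a base point by the Chinese remainder theorem and apply the
sieve count `RankZeroSieve.main_count`, which produces pairs with `4A³ + 27B²` squarefree away from
`2` and of the required sign). [cite: BhargavaShankarTernary2015, §4.1 (arXiv v2), "The set F is a large family"] -/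
theorem isLarge_bsFamily (s : Bool) : (bsFamily s).IsLarge := by
  refine ⟨3, fun p hp3 hp a b k hD ↦ ?_⟩
  have hp2 : p ≠ 2 := by omega
  obtain ⟨a₂, b₂, ha₂, hb₂⟩ := exists_bsBase s
  set k' : ℕ := max k 2 with hk'
  have hcop := isCoprime_two_pow_prime_pow hp hp2 k'
  obtain ⟨a₀, ha₀2, ha₀p⟩ := exists_modEq_and_modEq hcop a₂ a
  obtain ⟨b₀, hb₀2, hb₀p⟩ := exists_modEq_and_modEq hcop b₂ b
  -- the modulus of the sieve count
  set N : ℕ := 2 ^ 16 * p ^ k' with hNdef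
  have hN : 0 < N := by positivity
  have hNcast : (N : ℤ) = 2 ^ 16 * (p : ℤ) ^ k' := by simp [hNdef]
  have hpk : (p : ℤ) ^ 2 ∣ (p : ℤ) ^ k' := pow_dvd_pow _ (le_max_right k 2)
  have hDab : negDisc (a₀, b₀) ≡ negDisc (a, b) [ZMOD (p : ℤ) ^ 2] :=
    negDisc_modEq (ha₀p.of_dvd hpk) (hb₀p.of_dvd hpk)
  have hcompat : ∀ q : ℕ, q.Prime → q ≠ 2 → (q : ℤ) ∣ N →
      (q : ℤ) ^ 2 ∣ N ∧ ¬ (q : ℤ) ^ 2 ∣ negDisc (a₀, b₀) := by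
    intro q hq hq2 hqN
    have hqN' : q ∣ 2 ^ 16 * p ^ k' := by rw [hNdef] at hqN; exact_mod_cast hqN
    rcases (Nat.Prime.dvd_mul hq).mp hqN' with h | h
    · exact absurd ((Nat.prime_dvd_prime_iff_eq hq Nat.prime_two).mp (hq.dvd_of_dvd_pow h)) hq2
    · have hqp : q = p := (Nat.prime_dvd_prime_iff_eq hq hp).mp (hq.dvd_of_dvd_pow h)
      subst hqp
      refine ⟨?_, fun hdvd ↦ hD ?_⟩
      · rw [hNcast]; exact dvd_mul_of_dvd_right hpk _
      · rw [← negDisc_apply]; exact hDab.dvd_iff.mp hdvd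
  obtain ⟨X, AB, hbox, ⟨hA, hB⟩, hsq⟩ := exists_mem_box_class_oddSqfree s hN a₀ b₀ hcompat
  rw [hNcast] at hA hB
  have hA2 : AB.1 ≡ a₀ [ZMOD 2 ^ 16] := hA.of_dvd (dvd_mul_right _ _)
  have hB2 : AB.2 ≡ b₀ [ZMOD 2 ^ 16] := hB.of_dvd (dvd_mul_right _ _)
  have hAp : AB.1 ≡ a₀ [ZMOD (p : ℤ) ^ k'] := hA.of_dvd (dvd_mul_left _ _)
  have hBp : AB.2 ≡ b₀ [ZMOD (p : ℤ) ^ k'] := hB.of_dvd (dvd_mul_left _ _)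
  have hkk : (p : ℤ) ^ k ∣ (p : ℤ) ^ k' := pow_dvd_pow _ (le_max_left k 2)
  refine ⟨AB, ?_, (hAp.trans ha₀p).of_dvd hkk, (hBp.trans hb₀p).of_dvd hkk⟩
  rw [mem_bsFamily_iff]
  refine ⟨((hA2.trans ha₀2).of_dvd (by norm_num)).trans ha₂, ?_, hsq, ?_⟩
  · have : negDisc AB ≡ negDisc (a₂, b₂) [ZMOD 2 ^ 16] :=
      negDisc_modEq (hA2.trans ha₀2) (hB2.trans hb₀2)
    exact this.trans hb₂
  · cases s
    · simp only [Bool.false_eq_true, ↓reduceIte]; exact negDisc_neg_of_mem_box hbox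
    · simp only [↓reduceIte]; exact negDisc_pos_of_mem_box hbox

end Large

/-! ### Positive proportion -/

section Density

/-- Proportions are monotone in the property. [folklore] -/
theorem heightProportion_mono {P Q : ℤ × ℤ → Prop} (h : ∀ AB, P AB → Q AB) (X : ℕ) :
    heightProportion P X ≤ heightProportion Q X := by
  rw [heightProportion_eq_card_div P, heightProportion_eq_card_div Q]
  refine div_le_div_of_nonneg_right ?_ (Nat.cast_nonneg _)
  exact_mod_cast Finset.card_le_card (Finset.monotone_filter_right _ fun AB _ hP ↦ h AB hP)

/-- `X^{1/3} · X^{1/2} = X^{5/6}`. [folklore] -/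
theorem aX_mul_bX (X : ℕ) (hX : 1 ≤ X) : aX X * bX X = (X : ℝ) ^ (5 / 6 : ℝ) := by
  have hX0 : (0 : ℝ) < X := by exact_mod_cast hX
  unfold aX bX
  rw [Real.sqrt_eq_rpow, ← Real.rpow_add hX0]
  norm_num

/-- **The subfamily has positive proportion** (source §4.1: "an explicit positive proportion large
family"; there via Thm 37): eventually in `X`, the members of the sign-`+` piece form a proportion
`≥ c > 0` of all curves of naive height `< X`. Proof: the sieve count `RankZeroSieve.main_count` for
the `2`-adic class of the base point `(20, 176)` gives `≥ c₁ X^{5/6}` members of height `< X`, while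
the number of all curves of height `< X` is `~ c_F X^{5/6}` (the tree's
`card_heightFamilyBelow_asymptotic_holds`, `BhargavaShankarCountingProofs.lean`: Bhargava–Shankar,
Ann. of Math. 181 (2015) 191–242, Lemma 5.15).
[cite: BhargavaShankarTernary2015, §4.1 (arXiv v2), "an explicit positive proportion large family F"] -/
theorem exists_pos_le_heightProportion_isBSFamily :
    ∃ c : ℝ, 0 < c ∧ ∀ᶠ X : ℕ in atTop, c ≤ heightProportion (IsBSFamily true) X := by
  -- the sieve count for the base class modulo `2¹⁶`
  have hcompat : ∀ p : ℕ, p.Prime → p ≠ 2 → (p : ℤ) ∣ ((2 ^ 16 : ℕ) : ℤ) →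
      (p : ℤ) ^ 2 ∣ ((2 ^ 16 : ℕ) : ℤ) ∧ ¬ (p : ℤ) ^ 2 ∣ negDisc (20, 176) := by
    intro p hp hp2 hdvd
    have h' : p ∣ 2 ^ 16 := by exact_mod_cast hdvd
    exact absurd ((Nat.prime_dvd_prime_iff_eq hp Nat.prime_two).mp (hp.dvd_of_dvd_pow h')) hp2
  obtain ⟨c₁, hc₁, hev⟩ := main_count true (N := 2 ^ 16) (by norm_num) 20 176 hcompat
  -- the count of all curves
  set K : ℝ := |heightFamilyConstant| + 1 with hK
  have hK0 : 0 < K := by positivity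
  have hall : ∀ᶠ X : ℕ in atTop,
      ((heightFamilyBelow X).card : ℝ) / (X : ℝ) ^ (5 / 6 : ℝ) ≤ K :=
    card_heightFamilyBelow_asymptotic_holds.eventually_le_const
      (lt_of_le_of_lt (le_abs_self _) (lt_add_one _))
  refine ⟨c₁ / K, by positivity, ?_⟩
  filter_upwards [hev, hall, eventually_ge_atTop 1] with X hX1 hX2 hX3
  have hX0 : (0 : ℝ) < X := by exact_mod_cast hX3
  have hX56 : (0 : ℝ) < (X : ℝ) ^ (5 / 6 : ℝ) := Real.rpow_pos_of_pos hX0 _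
  rw [aX_mul_bX X hX3] at hX1
  rw [div_le_iff₀ hX56] at hX2
  -- the sieved pairs are members of height `< X`
  have hsub : (Ibox true X ×ˢ Jbox X).filter (fun AB : ℤ × ℤ ↦
      (AB.1 ≡ 20 [ZMOD ((2 ^ 16 : ℕ) : ℤ)] ∧ AB.2 ≡ 176 [ZMOD ((2 ^ 16 : ℕ) : ℤ)]) ∧ OddSqfree AB) ⊆
      (heightFamilyBelow X).filter (IsBSFamily true) := by
    intro AB hAB
    rw [Finset.mem_filter] at hAB ⊢
    obtain ⟨hbox, ⟨hA, hB⟩, hsq⟩ := hAB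
    push_cast at hA hB
    have hmem : IsBSFamily true AB := by
      refine ⟨(hA.of_dvd (by norm_num)).trans (by decide), ?_, hsq, ?_⟩
      · have h1 : negDisc AB ≡ negDisc (20, 176) [ZMOD 2 ^ 16] := negDisc_modEq hA hB
        refine h1.trans ?_
        simp only [bsResidue, ↓reduceIte, negDisc_apply]
        decide
      · simp only [↓reduceIte]; exact negDisc_pos_of_mem_box hbox
    refine ⟨?_, hmem⟩
    rw [mem_heightFamilyBelow_iff]
    refine ⟨hmem.isInHeightFamily, ?_⟩
    obtain ⟨h4, h27⟩ := height_lt_of_mem_box hX3 hbox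
    exact max_lt h4 h27
  have hcard := Finset.card_le_card hsub
  have hfilt : c₁ * (X : ℝ) ^ (5 / 6 : ℝ) ≤ ((heightFamilyBelow X).filter (IsBSFamily true)).card :=
    hX1.trans (by exact_mod_cast hcard)
  rw [heightProportion_eq_card_div]
  have hle : (((heightFamilyBelow X).filter (IsBSFamily true)).card : ℝ) ≤ (heightFamilyBelow X).card := by
    exact_mod_cast Finset.card_le_card (Finset.filter_subset _ _)
  have hallpos : (0 : ℝ) < (heightFamilyBelow X).card := by
    have : 0 < c₁ * (X : ℝ) ^ (5 / 6 : ℝ) := mul_pos hc₁ hX56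
    linarith
  rw [div_le_div_iff₀ hK0 hallpos]
  calc c₁ * ((heightFamilyBelow X).card : ℝ) ≤ c₁ * (K * (X : ℝ) ^ (5 / 6 : ℝ)) :=
        mul_le_mul_of_nonneg_left hX2 hc₁.le
    _ = K * (c₁ * (X : ℝ) ^ (5 / 6 : ℝ)) := by ring
    _ ≤ _ := by
        rw [mul_comm]
        exact mul_le_mul_of_nonneg_right hfilt hK0.le

/-- The union of the two sign pieces has positive proportion. [folklore] -/
theorem exists_pos_le_heightProportion_unionMem_bsFamilies :
    ∃ c : ℝ, 0 < c ∧ ∀ᶠ X : ℕ in atTop, c ≤ heightProportion (UnionMem bsFamilies) X := by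
  obtain ⟨c, hc, hev⟩ := exists_pos_le_heightProportion_isBSFamily
  refine ⟨c, hc, hev.mono fun X hX ↦ hX.trans (heightProportion_mono (fun AB h ↦ ?_) X)⟩
  exact (unionMem_bsFamilies_iff AB).mpr (Or.inl h)

end Density

/-! ### Assembly -/

section Assembly

/-- **The composite existence fact of `BSDRankZeroDensity.lean` from the single sentence.** Granted
`ω(E_{A,-B}) = -ω(E_{A,B})` on the subfamily (`rootNumber_negB_of_isBSFamily`), the two sign pieces
`bsFamilies` are pairwise disjoint large congruence families whose union is stable under
`E ↦ E₋₁`, reverses the root number under it, and has positive proportion: this is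
`exists_isLarge_rootNumber_twist_family`. [cite: BhargavaShankarTernary2015, §4.1 (arXiv v2)] -/
theorem exists_isLarge_rootNumber_twist_family_of_rootNumber_negB
    (h : rootNumber_negB_of_isBSFamily) : exists_isLarge_rootNumber_twist_family := by
  refine ⟨2, bsFamilies, ?_, bsFamilies_disjoint, fun AB ↦ unionMem_bsFamilies_negB, ?_,
    exists_pos_le_heightProportion_unionMem_bsFamilies⟩
  · intro i
    fin_cases i
    · exact isLarge_bsFamily true
    · exact isLarge_bsFamily false
  · intro AB hAB
    rw [unionMem_bsFamilies_iff] at hAB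
    rcases hAB with h' | h'
    · exact h true AB h'
    · exact h false AB h'

/-- **Theorem 4 of the source from three printed inputs.** If (h₁) the average of `#Sel^(3)` over
every large congruence family is eventually `≤ 4 + ε` (Thm 27), (h₃) the `p`-Selmer parity theorem of
Dokchitser–Dokchitser holds in the form of Thm 42, and (h₄) `ω(E₋₁) = -ω(E)` on the §4.1 family
(restricted to the subfamily `IsBSFamily`), then a positive proportion of elliptic curves over `ℚ`,
ordered by naive height, have Mordell–Weil rank `0`
(`Literature.NumberTheory.EllipticCurves.pos_proportion_rank_zero`). Composition of
`exists_isLarge_rootNumber_twist_family_of_rootNumber_negB` with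
`pos_proportion_rank_zero_of_facts` (`BSDRankZeroDensity.lean`).
[cite: BhargavaShankarTernary2015, Thm 4 and §4.1 (arXiv v2 numbering)] -/
theorem pos_proportion_rank_zero_of_facts₂ (h₁ : heightAverageOn_card_selmerThree_le_four)
    (h₃ : even_selmerRank_sub_torsionRank_iff) (h₄ : rootNumber_negB_of_isBSFamily) :
    pos_proportion_rank_zero :=
  pos_proportion_rank_zero_of_facts h₁ (exists_isLarge_rootNumber_twist_family_of_rootNumber_negB h₄)
    h₃

end Assembly

end Literature.NumberTheory.EllipticCurves

end
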